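import Mathlib
import Literature.NumberTheory.EllipticCurves.FermatQuarticDescent
import Literature.NumberTheory.DiophantineGeometry.EulerQuarticSixthPowers
import HarnessLib

/-!
# Generalized Fermat equations of signature `(2, 4, n)`: `A x ^ 4 + B y ^ 2 = C z ^ n`

Topic `Literature/NumberTheory/DiophantineGeometry` (same shelf as
`GeneralizedFermatSignatureNN2.lean` / `GeneralizedFermatSignatureNN3.lean`).

Content.
* `ellenberg2004_fourthPowerAddSquare` — Theorem 4.1 of J. S. Ellenberg, *Galois representations
  attached to `ℚ`-curves and the generalized Fermat equation `A⁴ + B² = Cᵖ`*, Amer. J. Math.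
  **126** (2004) 763–787 [Ellenberg2004], typed AS PRINTED from the held primary (arXiv
  math/0311497 = the journal text): `A⁴ + B² = Cᵖ`, `p ≥ 211`, `A, B` coprime ⇒ `AB = 0`.
* `bennettEllenbergNg2010_twiceSquareAddFourthPower` — the case `δ = 1` of M. A. Bennett,
  J. S. Ellenberg, N. C. Ng, *The Diophantine equation `A⁴ + 2^δ B² = Cⁿ`*, Int. J. Number Theory
  **6** (2010) 311–338 [BennettEllenbergNg2010]. The PRIMARY IS NOT HELD (paywalled; acquisition
  request acq-09945 of the venture cell `pub-abcsig`); the fact is vendored in the WEAKEST COMMON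
  FORM of two independent printed restatements, both quoted verbatim in the docstring:
  Ratcliffe–Grechuk, *Generalised Fermat equation: a survey of solved cases*, Expo. Math. 43
  (2025) [RatcliffeGrechuk2024], Theorem 2.6 (held), and the zbMATH review Zbl 1218.11035 of the
  primary. The case `δ = 0` of [BennettEllenbergNg2010] ("no solutions in coprime [nonzero] integers
  to `A⁴ + B² = Cⁿ` if `n ≥ 4`", Zbl 1218.11035) is NOT vendored: only one precise restatement is
  held and it omits the non-vanishing proviso; it waits for the primary.
* PROVED companions: the printed solution `2·11² + 1⁴ = 3⁵` is a genuine non-trivial primitive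
  solution (`bennettEllenbergNg2010_listed_solution`); the `r ≥ 6` half packaged as a plain
  non-existence statement (`….six_le`); and for Ellenberg's theorem the abstract's wording
  "no solutions in coprime positive integers" (`ellenberg2004_fourthPowerAddSquare.pos`).

UPDATE (2026-08-24, venture cell `pub-abcsig`, lit seat g9). The AUTHORS' FINAL DRAFT of
[BennettEllenbergNg2010] is openly posted by the first author
(`https://personal.math.ubc.ca/~bennett/BeElNgdraftFINAL.pdf`, entry [46] of his publication list;
23 pp.; lit-store key `paper:url-06633167fe27`; PDF sha256 `ab494abe3d7e…052ede2`). From it the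
paper's **Theorem 1** is now vendored AS PRINTED, both cases `δ = 0` and `δ = 1`, as
`bennettEllenbergNg2010_thm1` (draft p. 1; rendering notes in its docstring), with PROVED
companions: the earlier weakest-common-form fact `bennettEllenbergNg2010_twiceSquareAddFourthPower`
is a COROLLARY of the printed theorem (`bennettEllenbergNg2010_twiceSquareAddFourthPower_of_thm1`;
its own statement is left untouched), so is [Ellenberg2004, Thm 4.1]
(`ellenberg2004_fourthPowerAddSquare_of_thm1`), the "nonzero" readings of both sentences
(`….delta0_ne`, `….delta1_abs_eq`), and the case `n = 4` of `A⁴ + B² = Cⁿ` is PROVED OUTRIGHT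
(`fourthPow_add_sq_ne_fourthPow`, from Fermat's `x⁴ − y⁴ ≠ z²` in
`Literature.NumberTheory.EllipticCurves.FermatQuarticDescent`; the paper, §8: "the cases with
`n = 4` are relatively classical"). The journal pagination (IJNT 6 (2010) 311–338) is still not held;
locators below are draft pages.

Conventions. Ratcliffe–Grechuk's printed definitions (§1.2, p. 4 of the arXiv text) are used for
the survey-derived fact: a solution is *primitive* if `gcd(x, y, z) = 1` and *non-trivial* if
moreover `xyz ≠ 0`; `gcd(x, y, z) = 1` is rendered as "every common divisor of `x, y, z` is a
unit". Exponents are natural numbers. No discharge is attempted (proofs in print: `ℚ`-curves over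
`ℚ(i)` / `ℚ(√−2)`, Ellenberg's surjectivity theorem 3.14, an analytic estimate for `p ≥ 211`, and
in [BennettEllenbergNg2010] the computation of newforms of level `2p²`/`p²`/`256`/`512` with
nebentypus for the small exponents).
-/

namespace Literature.NumberTheory.DiophantineGeometry

/-- **Ellenberg 2004, Theorem 4.1** (Amer. J. Math. 126 (2004); arXiv math/0311497 §4), as
printed: "Suppose `A, B, C` are coprime integers such that `A⁴ + B² = Cᵖ` and `p ≥ 211`. Then
`AB = 0`." The paper's own gloss of the hypothesis (§4, first sentence of the proof): "a solution
… which is primitive (i.e., `(A, B) = 1`) and which is non-trivial (i.e., `AB ≠ 0`)"; abstract: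
"We prove that the equation `A⁴ + B² = Cᵖ` has no solutions in coprime positive integers when
`p ≥ 211`." Rendering: `p` a PRIME with `211 ≤ p` (the paper's `p` is the residual characteristic
of the mod-`p` representation throughout — Proposition 4.7: "Let `p > 13` be prime"; for composite
exponents nothing is claimed here), coprimality as `IsCoprime A B` (= the printed `(A, B) = 1`).
Printed context (§4, after Prop. 4.7): for `13 < p < 211` the same conclusion holds conditionally
on exhibiting a newform of level `2p²` or `p²` with prescribed Atkin–Lehner signs and
`L(f ⊗ χ₋₄, 1) ≠ 0` — not vendored (no newform vocabulary here); the unconditional extension to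
all `n ≥ 4` is [BennettEllenbergNg2010] (primary not held, see the module docstring).
[cite: Ellenberg2004, Thm 4.1] -/
def ellenberg2004_fourthPowerAddSquare : Prop :=
  ∀ p : ℕ, p.Prime → 211 ≤ p → ∀ A B C : ℤ, IsCoprime A B → A ^ 4 + B ^ 2 = C ^ p → A * B = 0

/-- The abstract's wording of [Ellenberg2004]: "no solutions in coprime positive integers when
`p ≥ 211`" — immediate from the named fact. [cite: Ellenberg2004, Abstract and Thm 4.1] -/
theorem ellenberg2004_fourthPowerAddSquare.pos (h : ellenberg2004_fourthPowerAddSquare) {p : ℕ}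
    (hp : p.Prime) (h211 : 211 ≤ p) {A B C : ℤ} (hA : 0 < A) (hB : 0 < B)
    (hcop : IsCoprime A B) : A ^ 4 + B ^ 2 ≠ C ^ p := by
  intro hE
  have := h p hp h211 A B C hcop hE
  rcases mul_eq_zero.mp this with h0 | h0 <;> omega

/-- "`gcd(x, y, z) = 1`" (Ratcliffe–Grechuk's *primitive*, §1.2: "ones satisfying
`gcd(x, y, z) = 1`"), rendered as: every common divisor of `x, y, z` is a unit.
[cite: RatcliffeGrechuk2024, §1.2 (definition of primitive solution)] -/
def IsPrimitiveTriple (x y z : ℤ) : Prop :=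
  ∀ d : ℤ, d ∣ x → d ∣ y → d ∣ z → IsUnit d

/-- Unfolding lemma for `IsPrimitiveTriple`.
[cite: RatcliffeGrechuk2024, §1.2 (definition of primitive solution)] -/
theorem isPrimitiveTriple_iff (x y z : ℤ) :
    IsPrimitiveTriple x y z ↔ ∀ d : ℤ, d ∣ x → d ∣ y → d ∣ z → IsUnit d := Iff.rfl

/-- A pairwise-coprime pair already makes the triple primitive. [cite: RatcliffeGrechuk2024, §1.2
and Prop. 1.3 (primitive vs pairwise coprime)] -/
theorem IsPrimitiveTriple.of_isCoprime_left {x y : ℤ} (h : IsCoprime x y) (z : ℤ) :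
    IsPrimitiveTriple x y z :=
  fun _ hx hy _ => h.isUnit_of_dvd' hx hy

/-- **Bennett–Ellenberg–Ng 2010, the case `δ = 1`: `2x² + y⁴ = zʳ`** — WEAKEST COMMON FORM of two
printed restatements (primary [BennettEllenbergNg2010], Int. J. Number Theory 6 (2010) 311–338,
not held: acq-09945):
(i) Ratcliffe–Grechuk [RatcliffeGrechuk2024], Theorem 2.6 (arXiv text p. 8), verbatim: "In 2010,
Bennett, Ellenberg and Ng significantly strengthened this result and completely solved equation
(`2x² + y⁴ = zʳ`, `r ≥ 5`) for all integers `r ≥ 5`. **Theorem 2.6.** The equation `2x² + y⁴ = zʳ`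
has no non-trivial primitive solutions for integer `r ≥ 6`, while for `r = 5` its only non-trivial
primitive integer solutions are `(x, y, z) = (±11, ±1, 3)`." (their summary table, p. 23:
"`2x² + y⁴ = zⁿ`, `n ≥ 5`: Solved [bennett2010diophantine]"; definitions §1.2: primitive =
`gcd(x, y, z) = 1`, non-trivial = primitive with `xyz ≠ 0`);
(ii) zbMATH review Zbl 1218.11035 of the primary, verbatim: "The only solution in positive coprime
integers `A, B, C` to the equation `A⁴ + 2B² = Cⁿ` is `(A, B, C, n) = (1, 11, 3, 5)` if `n ≥ 4`."
Common form vendored: integer exponents `r ≥ 5` (the review's `n = 4` is not in the survey's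
scope `1/2 + 1/4 + 1/r < 1`), nonzero `x, y, z` with `gcd(x, y, z) = 1`, conclusion "`r = 5` and
`(|x|, |y|, z) = (11, 1, 3)`" (`2·11² + 1 = 243 = 3⁵`). Signs: `z = 3` as printed in (i) (for
`r = 5` odd, `z < 0` would make the right-hand side negative).
[cite: RatcliffeGrechuk2024, Thm 2.6] [cite: BennettEllenbergNg2010, Thm 1 (case δ = 1) via Zbl 1218.11035] -/
def bennettEllenbergNg2010_twiceSquareAddFourthPower : Prop :=
  ∀ r : ℕ, 5 ≤ r → ∀ x y z : ℤ, x ≠ 0 → y ≠ 0 → z ≠ 0 → IsPrimitiveTriple x y z →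
    2 * x ^ 2 + y ^ 4 = z ^ r → r = 5 ∧ |x| = 11 ∧ |y| = 1 ∧ z = 3

/-- The solutions listed in `bennettEllenbergNg2010_twiceSquareAddFourthPower` are genuine
non-trivial primitive solutions: `2·(±11)² + (±1)⁴ = 243 = 3⁵` (printed: [RatcliffeGrechuk2024,
Thm 2.6]; Zbl 1218.11035: `(A, B, C, n) = (1, 11, 3, 5)` for `A⁴ + 2B² = Cⁿ`).
[cite: RatcliffeGrechuk2024, Thm 2.6 (listed solutions)] -/
theorem bennettEllenbergNg2010_listed_solution :
    (∀ x y : ℤ, |x| = 11 → |y| = 1 → 2 * x ^ 2 + y ^ 4 = (3 : ℤ) ^ 5) ∧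
    IsPrimitiveTriple 11 1 3 ∧ (11 : ℤ) ≠ 0 ∧ (1 : ℤ) ≠ 0 ∧ (3 : ℤ) ≠ 0 := by
  refine ⟨fun x y hx hy => ?_, ?_, by norm_num, by norm_num, by norm_num⟩
  · have hx2 : x ^ 2 = 121 := by
      have : |x| ^ 2 = 121 := by rw [hx]; norm_num
      rwa [sq_abs] at this
    have hy4 : y ^ 4 = 1 := by
      have : |y| ^ 4 = 1 := by rw [hy]; norm_num
      have h4 : y ^ 4 = |y| ^ 4 := by
        rw [show (4 : ℕ) = 2 * 2 from rfl, pow_mul, pow_mul, sq_abs]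
      rw [h4, this]
    rw [hx2, hy4]; norm_num
  · exact IsPrimitiveTriple.of_isCoprime_left isCoprime_one_right 3

/-- **[BennettEllenbergNg2010], `δ = 1`, exponents `r ≥ 6`** packaged: `2x² + y⁴ = zʳ` has no
solution in nonzero integers with `gcd(x, y, z) = 1` — verbatim the first half of
[RatcliffeGrechuk2024, Thm 2.6]. Proved from the named fact.
[cite: RatcliffeGrechuk2024, Thm 2.6 (r ≥ 6)] -/
theorem bennettEllenbergNg2010_twiceSquareAddFourthPower.six_le
    (h : bennettEllenbergNg2010_twiceSquareAddFourthPower) {r : ℕ} (hr : 6 ≤ r) {x y z : ℤ}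
    (hx : x ≠ 0) (hy : y ≠ 0) (hz : z ≠ 0) (hprim : IsPrimitiveTriple x y z) :
    2 * x ^ 2 + y ^ 4 ≠ z ^ r := by
  intro hE
  have h5 := (h r (by omega) x y z hx hy hz hprim hE).1
  omega

/-! ## [BennettEllenbergNg2010] Theorem 1 as printed (authors' final draft), and proved companions -/

/-- A primitive triple stays primitive when each entry is replaced by a divisor of itself (used with
`|x| ∣ x`). [cite: RatcliffeGrechuk2024, §1.2 (definition of primitive solution)] -/
theorem IsPrimitiveTriple.of_dvd {x y z x' y' z' : ℤ} (h : IsPrimitiveTriple x y z)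
    (hx : x' ∣ x) (hy : y' ∣ y) (hz : z' ∣ z) : IsPrimitiveTriple x' y' z' :=
  fun d hdx hdy hdz => h d (hdx.trans hx) (hdy.trans hy) (hdz.trans hz)

/-- Taking absolute values preserves primitivity.
[cite: RatcliffeGrechuk2024, §1.2 (definition of primitive solution)] -/
theorem IsPrimitiveTriple.abs {x y z : ℤ} (h : IsPrimitiveTriple x y z) :
    IsPrimitiveTriple |x| |y| |z| :=
  h.of_dvd ((abs_dvd x x).mpr dvd_rfl) ((abs_dvd y y).mpr dvd_rfl) ((abs_dvd z z).mpr dvd_rfl)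

/-- **Bennett–Ellenberg–Ng 2010, Theorem 1**, AS PRINTED in the authors' final draft (p. 1 of
`https://personal.math.ubc.ca/~bennett/BeElNgdraftFINAL.pdf` = Int. J. Number Theory **6** (2010)
311–338), verbatim: "**Theorem 1.** There are no solutions in coprime integers `A, B, C` to the
equation `A⁴ + B² = Cⁿ` with `(A, B, C) = 1` and `n ≥ 4`. The only solution in positive coprime
integers `A, B, C` to the equation `A⁴ + 2B² = Cⁿ` with `n ≥ 4` is `(A, B, C, n) = (1, 11, 3, 5)`."
Rendering. `(A, B, C) = 1` / "coprime integers `A, B, C`" = `IsPrimitiveTriple A B C`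
(`gcd(A, B, C) = 1`; pairwise coprimality follows from either equation and is not assumed).
`A, B, C` are taken POSITIVE in BOTH sentences: the second sentence prints "positive"; the first,
read literally, is contradicted by the trivial coprime solutions with `AB = 0` (e.g.
`0⁴ + 1² = 1ⁿ`), and the paper's own usage fixes the intended scope — Proposition 6 speaks of "a
nontrivial solution", Proposition 8 (the small-exponent half of Theorem 1: "Equation (5)
[`A⁴ + B² = Cⁿ`, `n ∈ {4, 5, 6, 9}`] has no solutions in positive coprime integers, while the only
such solution to equation (6) [`A⁴ + 2B² = Cⁿ`, `n ∈ {4, 5, 6, 7, 9}`] is `(A, B, C, n) =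
(1, 11, 3, 5)`") of "positive coprime integers", and §8 (draft p. 19) calls the solutions with
`ABC = 0` the trivial ones. This is a RECORDED READING, not a weakening: the sign-free "nonzero"
forms are proved below from this one (`….delta0_ne`, `….delta1_abs_eq`: `A ↦ −A`, `B ↦ −B`,
and `C < 0` is impossible for odd `n`, `C ↦ −C` for even `n`). Exponent `n` a natural number
`≥ 4` (all integers `n ≥ 4`, prime or not, as printed). Proof in print: Frey `ℚ`-curves (3), (4)
over `ℚ(i)`, `ℚ(√−2)`, modularity and Ellenberg's image theorem, an analytic non-vanishing
estimate for `(a₁, L_χ)^{p-new}_{p²}` (Lemma 15: `p ≥ 61` for `χ₋₄`, `p ≥ 97` for `χ₋₈`),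
explicit newforms of level `p²`, `2p²` for `7 ≤ p ≤ 89` (§7 tables), and Chabauty / rank-0
elliptic-curve arguments for `n ∈ {4, 5, 6, 7, 9}` (Proposition 8); not formalised here.
[cite: BennettEllenbergNg2010, Thm 1 (authors' final draft p. 1; Prop. 8 p. 4)] -/
def bennettEllenbergNg2010_thm1 : Prop :=
  (∀ n : ℕ, 4 ≤ n → ∀ A B C : ℤ, 0 < A → 0 < B → 0 < C → IsPrimitiveTriple A B C →
      A ^ 4 + B ^ 2 ≠ C ^ n) ∧
  (∀ n : ℕ, 4 ≤ n → ∀ A B C : ℤ, 0 < A → 0 < B → 0 < C → IsPrimitiveTriple A B C →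
      A ^ 4 + 2 * B ^ 2 = C ^ n → A = 1 ∧ B = 11 ∧ C = 3 ∧ n = 5)

/-- The solution listed in [BennettEllenbergNg2010, Thm 1] is a genuine positive primitive
solution: `1⁴ + 2·11² = 243 = 3⁵` (draft p. 21: "they lead to the identity `1⁴ + 2·11² = 3⁵`").
[cite: BennettEllenbergNg2010, Thm 1 and §9 (listed solution)] -/
theorem bennettEllenbergNg2010_thm1_listed_solution :
    (1 : ℤ) ^ 4 + 2 * 11 ^ 2 = 3 ^ 5 ∧ IsPrimitiveTriple 1 11 3 ∧
      (0 : ℤ) < 1 ∧ (0 : ℤ) < 11 ∧ (0 : ℤ) < 3 :=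
  ⟨by norm_num, IsPrimitiveTriple.of_isCoprime_left isCoprime_one_left 3, by norm_num, by norm_num,
    by norm_num⟩

/-- **[BennettEllenbergNg2010, Thm 1], first sentence, sign-free reading**: for `n ≥ 4` there is
no solution of `A⁴ + B² = Cⁿ` with `A ≠ 0`, `B ≠ 0` and `gcd(A, B, C) = 1` (the intended
"nontrivial" scope of the printed sentence; Proposition 6: "a nontrivial solution"). Proved from
the positive form by `A ↦ |A|`, `B ↦ |B|`, and `C ↦ |C|` (even `n`) / `C > 0` (odd `n`, since
`Cⁿ = A⁴ + B² > 0`). [cite: BennettEllenbergNg2010, Thm 1 (first sentence) and Prop. 6] -/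
theorem bennettEllenbergNg2010_thm1.delta0_ne (h : bennettEllenbergNg2010_thm1) {n : ℕ}
    (hn : 4 ≤ n) {A B C : ℤ} (hA : A ≠ 0) (hB : B ≠ 0) (hprim : IsPrimitiveTriple A B C) :
    A ^ 4 + B ^ 2 ≠ C ^ n := by
  intro hE
  have hA4 : 0 < A ^ 4 := Even.pow_pos (by decide) hA
  have hB2 : 0 < B ^ 2 := Even.pow_pos (by decide) hB
  have hpos : 0 < C ^ n := by rw [← hE]; exact add_pos hA4 hB2
  have hA' : |A| ^ 4 = A ^ 4 := Even.pow_abs (by decide) A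
  have hB' : |B| ^ 2 = B ^ 2 := Even.pow_abs (by decide) B
  rcases Nat.even_or_odd n with hev | hodd
  · have hC0 : C ≠ 0 := by
      rintro rfl
      rw [zero_pow (by omega)] at hpos
      exact lt_irrefl _ hpos
    refine h.1 n hn |A| |B| |C| (abs_pos.mpr hA) (abs_pos.mpr hB) (abs_pos.mpr hC0) hprim.abs ?_
    rw [hA', hB', hev.pow_abs, hE]
  · have hC : 0 < C := hodd.pow_pos_iff.mp hpos
    refine h.1 n hn |A| |B| C (abs_pos.mpr hA) (abs_pos.mpr hB) hC
      (hprim.of_dvd ((abs_dvd A A).mpr dvd_rfl) ((abs_dvd B B).mpr dvd_rfl) dvd_rfl) ?_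
    rw [hA', hB', hE]

/-- **[BennettEllenbergNg2010, Thm 1], second sentence, sign-free reading**: for `n ≥ 4`, a
solution of `A⁴ + 2B² = Cⁿ` with `A ≠ 0`, `B ≠ 0`, `gcd(A, B, C) = 1` has
`(|A|, |B|, |C|, n) = (1, 11, 3, 5)`. Proved from the positive form as for `….delta0_ne`.
[cite: BennettEllenbergNg2010, Thm 1 (second sentence)] -/
theorem bennettEllenbergNg2010_thm1.delta1_abs_eq (h : bennettEllenbergNg2010_thm1) {n : ℕ}
    (hn : 4 ≤ n) {A B C : ℤ} (hA : A ≠ 0) (hB : B ≠ 0) (hprim : IsPrimitiveTriple A B C)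
    (hE : A ^ 4 + 2 * B ^ 2 = C ^ n) : |A| = 1 ∧ |B| = 11 ∧ |C| = 3 ∧ n = 5 := by
  have hA4 : 0 < A ^ 4 := Even.pow_pos (by decide) hA
  have hB2 : 0 < B ^ 2 := Even.pow_pos (by decide) hB
  have hpos : 0 < C ^ n := by rw [← hE]; linarith
  have hA' : |A| ^ 4 = A ^ 4 := Even.pow_abs (by decide) A
  have hB' : |B| ^ 2 = B ^ 2 := Even.pow_abs (by decide) B
  rcases Nat.even_or_odd n with hev | hodd
  · have hC0 : C ≠ 0 := by
      rintro rfl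
      rw [zero_pow (by omega)] at hpos
      exact lt_irrefl _ hpos
    obtain ⟨h1, h2, h3, h4⟩ := h.2 n hn |A| |B| |C| (abs_pos.mpr hA) (abs_pos.mpr hB)
      (abs_pos.mpr hC0) hprim.abs (by rw [hA', hB', hev.pow_abs, hE])
    exact ⟨h1, h2, h3, h4⟩
  · have hC : 0 < C := hodd.pow_pos_iff.mp hpos
    obtain ⟨h1, h2, h3, h4⟩ := h.2 n hn |A| |B| C (abs_pos.mpr hA) (abs_pos.mpr hB) hC
      (hprim.of_dvd ((abs_dvd A A).mpr dvd_rfl) ((abs_dvd B B).mpr dvd_rfl) dvd_rfl)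
      (by rw [hA', hB', hE])
    exact ⟨h1, h2, by rw [h3]; norm_num, h4⟩

/-- The weakest-common-form fact `bennettEllenbergNg2010_twiceSquareAddFourthPower` (vendored
2026-08-23 from [RatcliffeGrechuk2024, Thm 2.6] ∩ Zbl 1218.11035 while the primary was not held)
FOLLOWS from the printed Theorem 1: for `r ≥ 5`, nonzero `x, y, z` with `gcd(x, y, z) = 1` and
`2x² + y⁴ = zʳ`, the sign-free reading gives `(|y|, |x|, |z|, r) = (1, 11, 3, 5)`, and `r = 5` odd
forces `z > 0`. (The primary is stronger: it also covers `n = 4`.)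
[cite: BennettEllenbergNg2010, Thm 1] [cite: RatcliffeGrechuk2024, Thm 2.6] -/
theorem bennettEllenbergNg2010_twiceSquareAddFourthPower_of_thm1 (h : bennettEllenbergNg2010_thm1) :
    bennettEllenbergNg2010_twiceSquareAddFourthPower := by
  intro r hr x y z hx hy hz hprim hE
  have hprim' : IsPrimitiveTriple y x z := fun d hdy hdx hdz => hprim d hdx hdy hdz
  obtain ⟨h1, h2, h3, h4⟩ := bennettEllenbergNg2010_thm1.delta1_abs_eq h (n := r) (by omega) hy hx
    hprim' (by linear_combination hE)
  subst h4
  have hzpos : 0 < z := by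
    have h5 : Odd 5 := by decide
    have : 0 < z ^ 5 := by rw [← hE]; positivity
    exact h5.pow_pos_iff.mp this
  exact ⟨rfl, h2, h1, by rw [abs_of_pos hzpos] at h3; exact h3⟩

/-- [Ellenberg2004, Thm 4.1] (`A⁴ + B² = Cᵖ`, `p ≥ 211` prime, `(A, B) = 1 ⇒ AB = 0`) FOLLOWS
from [BennettEllenbergNg2010, Thm 1] (all `n ≥ 4`): a pair `(A, B) = 1` makes the triple primitive,
and `AB ≠ 0` would contradict the sign-free reading. (The 2010 paper, p. 1: "In [10], the second
author proved that the equation `A⁴ + B² = Cᵖ` had no integral solutions for prime `p > 211` and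
`(A, B, C) = 1`. In the present paper, we explain how to extend this result to smaller exponents".)
[cite: BennettEllenbergNg2010, Thm 1 and §1] [cite: Ellenberg2004, Thm 4.1] -/
theorem ellenberg2004_fourthPowerAddSquare_of_thm1 (h : bennettEllenbergNg2010_thm1) :
    ellenberg2004_fourthPowerAddSquare := by
  intro p _hp h211 A B C hcop hE
  by_contra hAB
  obtain ⟨hA, hB⟩ := mul_ne_zero_iff.mp hAB
  exact bennettEllenbergNg2010_thm1.delta0_ne h (n := p) (by omega) hA hB
    (IsPrimitiveTriple.of_isCoprime_left hcop C) hE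

/-- **The case `n = 4` of `A⁴ + B² = Cⁿ`, PROVED**: for `A ≠ 0`, `B ≠ 0`, `A⁴ + B² ≠ C⁴` — this is
Fermat's theorem that `x⁴ − y⁴ = z²` has no solution with `yz ≠ 0` (`C⁴ − A⁴ = B²`), available in
the tree as `Literature.NumberTheory.EllipticCurves.fermat_fourth_pow_sub_fourth_pow_ne_sq`
([Koshy2001, Thm 13.3]). [BennettEllenbergNg2010, §8] (draft p. 19): "the cases with `n = 4` are
relatively classical" (there via Cremona's curve 32a1 of rank 0). No coprimality is needed.
[cite: BennettEllenbergNg2010, §8 (n = 4)] [cite: Koshy2001, Thm 13.3] -/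
theorem fourthPow_add_sq_ne_fourthPow {A B C : ℤ} (hA : A ≠ 0) (hB : B ≠ 0) :
    A ^ 4 + B ^ 2 ≠ C ^ 4 := by
  intro hE
  exact Literature.NumberTheory.EllipticCurves.fermat_fourth_pow_sub_fourth_pow_ne_sq (a := C) hA hB
    (by linear_combination -hE)

/-- The `n = 4` instance of the first clause of `bennettEllenbergNg2010_thm1`, PROVED
unconditionally (Fermat; `fourthPow_add_sq_ne_fourthPow`).
[cite: BennettEllenbergNg2010, Thm 1 and §8 (n = 4)] -/
theorem bennettEllenbergNg2010_thm1.delta0_four :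
    ∀ A B C : ℤ, 0 < A → 0 < B → 0 < C → IsPrimitiveTriple A B C → A ^ 4 + B ^ 2 ≠ C ^ 4 :=
  fun _ _ _ hA hB _ _ => fourthPow_add_sq_ne_fourthPow hA.ne' hB.ne'

/-! ## The case `n = 4` of the second clause: `A⁴ + 2B² = C⁴` (Euler–Legendre), proved -/

/-- **`A⁴ + 2B² ≠ C⁴` for `A ≠ 0`, `B ≠ 0`** — i.e. `x⁴ − y⁴ = 2z²` has no solution with
`xyz ≠ 0` (Euler–Legendre; printed e.g. as [EsmondeMurty1999, Exercise 1.4.7]: "Show that there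
are no integer solutions to the equation `x⁴ − y⁴ = 2z²`", solution pp. 174–175). Proof by the
identity `(C⁴ − A⁴)² + 4A⁴C⁴ = (C⁴ + A⁴)²`: with `C⁴ − A⁴ = 2B²` and `C⁴ + A⁴ = 2(A⁴ + B²)` it reads
`B⁴ + (AC)⁴ = (A⁴ + B²)²`, contradicting Fermat's `X⁴ + Y⁴ ≠ Z²` (Mathlib `not_fermat_42`). The same
fact, with the same proof, is `Literature.NumberTheory.Automorphic.pow_four_sub_pow_four_ne_two_mul_sq`
(not imported here to keep this file's imports light). This is the case `n = 4` of the second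
equation of [BennettEllenbergNg2010, Thm 1], which the paper (§8, draft p. 19) settles by "an
elliptic curve over `ℚ` of conductor `64` and rank `0`; again only trivial solutions accrue". (The
case `A = 0`, `2B² = C⁴`, is the irrationality of `√2` and is not needed below.)
[cite: EsmondeMurty1999, Ex. 1.4.7] [cite: BennettEllenbergNg2010, §8 (n = 4)] -/
theorem fourthPow_add_two_mul_sq_ne_fourthPow {A B C : ℤ} (hA : A ≠ 0) (hB : B ≠ 0) :
    A ^ 4 + 2 * B ^ 2 ≠ C ^ 4 := by
  intro h
  have hC : C ≠ 0 := by
    rintro rfl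
    have : 0 < A ^ 4 + 2 * B ^ 2 := by positivity
    rw [h] at this
    norm_num at this
  have key : B ^ 4 + (A * C) ^ 4 = (A ^ 4 + B ^ 2) ^ 2 := by
    linear_combination (-(A ^ 4)) * h
  exact not_fermat_42 hB (mul_ne_zero hA hC) key

/-- The `n = 4` instance of the SECOND clause of `bennettEllenbergNg2010_thm1`, PROVED
unconditionally (vacuously: there is no positive solution of `A⁴ + 2B² = C⁴`,
`fourthPow_add_two_mul_sq_ne_fourthPow`). [cite: BennettEllenbergNg2010, Thm 1 and §8 (n = 4)] -/
theorem bennettEllenbergNg2010_thm1.delta1_four :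
    ∀ A B C : ℤ, 0 < A → 0 < B → 0 < C → IsPrimitiveTriple A B C →
      A ^ 4 + 2 * B ^ 2 = C ^ 4 → A = 1 ∧ B = 11 ∧ C = 3 ∧ 4 = 5 :=
  fun _ _ _ hA hB _ _ hE => absurd hE (fourthPow_add_two_mul_sq_ne_fourthPow hA.ne' hB.ne')

/-- **Both clauses of [BennettEllenbergNg2010, Thm 1] at the exponent `n = 4` hold outright**
(Fermat / Euler–Legendre: `fourthPow_add_sq_ne_fourthPow`, `fourthPow_add_two_mul_sq_ne_fourthPow`);
the printed theorem is needed only for `n ≥ 5`. [cite: BennettEllenbergNg2010, Thm 1 and §8 (n = 4)] -/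
theorem bennettEllenbergNg2010_thm1.four :
    (∀ A B C : ℤ, 0 < A → 0 < B → 0 < C → IsPrimitiveTriple A B C → A ^ 4 + B ^ 2 ≠ C ^ 4) ∧
    (∀ A B C : ℤ, 0 < A → 0 < B → 0 < C → IsPrimitiveTriple A B C →
      A ^ 4 + 2 * B ^ 2 = C ^ 4 → A = 1 ∧ B = 11 ∧ C = 3 ∧ 4 = 5) :=
  ⟨bennettEllenbergNg2010_thm1.delta0_four, bennettEllenbergNg2010_thm1.delta1_four⟩

/-- For a solution of `A⁴ + k·B² = Cⁿ` (any `n`; `k = 1, 2` are the cases of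
[BennettEllenbergNg2010]), `gcd(A, B, C) = 1` already forces `gcd(A, B) = 1`: a common prime of
`A` and `B` divides `Cⁿ`, hence `C`. So the paper's "(A, B, C) = 1" and Ellenberg's "(A, B) = 1"
describe the same solutions. [cite: BennettEllenbergNg2010, Thm 1 (hypothesis "(A, B, C) = 1")]
[cite: Ellenberg2004, §4 ("primitive (i.e., (A, B) = 1)")] -/
theorem IsPrimitiveTriple.isCoprime_of_eq {A B C k : ℤ} {n : ℕ}
    (h : IsPrimitiveTriple A B C) (hE : A ^ 4 + k * B ^ 2 = C ^ n) : IsCoprime A B := by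
  rw [Int.isCoprime_iff_gcd_eq_one]
  by_contra hg
  obtain ⟨p, hp, hpA, hpB⟩ := Nat.Prime.not_coprime_iff_dvd.mp hg
  have hpA' : (p : ℤ) ∣ A := Int.natCast_dvd.mpr hpA
  have hpB' : (p : ℤ) ∣ B := Int.natCast_dvd.mpr hpB
  have hpZ : Prime (p : ℤ) := Nat.prime_iff_prime_int.mp hp
  have hpCn : (p : ℤ) ∣ C ^ n := by
    rw [← hE]
    exact dvd_add (dvd_pow hpA' (by norm_num)) (dvd_mul_of_dvd_right (dvd_pow hpB' two_ne_zero) k)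
  have hpC : (p : ℤ) ∣ C := hpZ.dvd_of_dvd_pow hpCn
  have hu : IsUnit (p : ℤ) := h p hpA' hpB' hpC
  rw [Int.isUnit_iff] at hu
  have := hp.two_le
  omega

/-! ## The case `n = 6` of the first clause: `A⁴ + B² ≠ C⁶` (signature `(2, 4, 6)`, Bruin 1999; Cohen Prop. 14.6.8), proved -/

/-- The `n = 6` instance of the first clause of `bennettEllenbergNg2010_thm1`, PROVED unconditionally:
`A⁴ + B² = C⁶` has no solution in positive integers with `gcd(A, B, C) = 1` — the generalized Fermat
equation of signature `(2, 4, 6)` (N. Bruin 1999), in the tree as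
`Literature.NumberTheory.DiophantineGeometry.fourthPow_add_sq_ne_sixthPow`
(`EulerQuarticSixthPowers.lean`: [Cohen2007NumberTheoryII, Prop. 14.6.8] `x⁶ − y⁴ = z²`, proved there by
the dihedral parametrisation and an explicit descent via `2`-isogeny replacing the book's "mwrank");
`gcd(A, B, C) = 1` gives `gcd(A, B) = 1` by `IsPrimitiveTriple.isCoprime_of_eq`.
[cite: BennettEllenbergNg2010, Thm 1 (n = 6)] [cite: Cohen2007NumberTheoryII, Prop. 14.6.8] -/
theorem bennettEllenbergNg2010_thm1.delta0_six :
    ∀ A B C : ℤ, 0 < A → 0 < B → 0 < C → IsPrimitiveTriple A B C → A ^ 4 + B ^ 2 ≠ C ^ 6 :=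
  fun _ _ _ hA hB _ hP hE =>
    fourthPow_add_sq_ne_sixthPow (hP.isCoprime_of_eq (k := 1) (n := 6) (by rw [one_mul]; exact hE))
      hA.ne' hB.ne' hE


end Literature.NumberTheory.DiophantineGeometry
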